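import Literature.MathematicalPhysics.QuantumFieldTheory.Balaban1983to89.B4LatticeBoxChart
import Literature.MathematicalPhysics.QuantumFieldTheory.Balaban1983to89.B4RegionDecoupling

/-!
# `Balaban1983to89.B4TorusBandLift` — [Balaban1983RegularityDecay] THEOREM p. 573 (1.9)–(1.10) «for rectangular
# parallelepipeds … without any restrictions on the points x, x′» ON THE PERIODIC LIFT OF AN ARBITRARY PARALLELEPIPED
# OF THE TORUS (wrapping or not): the lift is a union of SEPARATED translated lattice parallelepipeds, on each of which
# the box lineage's Theorem holds without restriction — hence `Ineq19_110` on r01's lifted instance with `R₀ = 0`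

statement-level skeleton of published theorems with citation tags; proofs where landed; nothing here is a claim about the Yang–Mills mass gap

CITATION HEADER.  T. Bałaban, *Regularity and decay of lattice Green's functions*, Commun. Math. Phys. **89** (1983)
571–597, doi:10.1007/bf01214744 [Balaban1983RegularityDecay] (cell paper B4; held text
`paper:balaban1983-cmp89-regularity-decay`, journal page = PDF page + 570; p. 573 [PDF 3] Theorem and its last sentence,
p. 572 [PDF 2] «operators on subsets of a torus T_η which we identify with a rectangular parallelepiped in ηZ^d with
periodic conditions»).  Seat `pub-ymgap-dag-p3` gen 4 (Track A, YM-PLAN §2 node N01 = [B4]; HOME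
`run/shared/lean/pub/pub-ymgap/`): THIRD BRICK of the route to the `rect` residual (i) of N01's cross-read (bricks 1–2:
`B4RegionDecoupling`, `B4LatticeBoxChart`).  A parallelepiped `Ω` of `T_η` = the unit blocks with labels in a box
`o + Π[0,Ms) ⊆ Π[0,P)`; in each direction either `Ms_ν + 1 ≤ P_ν` (proper) or `Ms_ν = P_ν` (the box wraps all the way
round; then `o_ν = 0`) — dag-p3 g3's `TorusBoxInst` is the all-proper case.  r01 g9's periodic lift
`liftLabels P R Ω` (the `(2R+1)^{d+1}` translates) is the disjoint union, over the copy indices `s` of the proper directions,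
of the label boxes `C_s = Π_{ν proper}[o_ν + P_νs_ν, o_ν + P_νs_ν + Ms_ν) × Π_{ν wrapping}[−RP_ν, (R+1)P_ν)`, any two
of which are at `ℓ^∞`-distance `≥ 2` (§1); so `B4RegionDecoupling` reads `G_k`, `D^η_{A,μ}` and the contours of the lift
component by component, `B4LatticeBoxChart` puts the box Theorem on each component, and the three members of (1.9)–(1.10)
hold at EVERY site of the lift (§3) — exactly the hypothesis `HI` of r01 g9's lifting members `valG_torus`,
`valDG_torus`, `lhs19_torus` with `R₀ = 0` (the torus assembly is the next file).

WHAT THIS MODULE PROVES (kernel, sorry-free).  §0 `TorusBandInst` (g3's `TorusBoxInst` WITHOUT `hwrap`), its torus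
pair `toInst` (`Ω ⊂ T_η`, r01's `TorusPairInst`), `lift R` (r01's lifted lattice instance, reducible alias — every
carrier below is spelled through its fields), `cM R`, `co R s` (sides and corner of the component `C_s`),
`comp R s : LatBoxInst` (the component as a lattice parallelepiped at the lifted instance's field, scale and windows).
§1 `corner_bounds`, `comp_subset_lift` ∕ `comp_subset_liftΩ` (`C_s ⊆` the lift, `|s| ≤ R`), `mem_comp_cidx` (every
label of the lift lies in `C_{cidx}`), `comp_label_separated` (a label of the lift within `ℓ^∞`-distance `1` of `C_s`
lies in `C_s`), `comp_separated` (the fine-level separation hypothesis of `B4RegionDecoupling`).  §2 `pairInst R hs`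
(the pair `C_s ⊂ Ω̃_R` as r01's `RegionPairInst`), `resR_GΩ_lift`, `fld_GΩ_lift_incl`, `fld_DΩGΩ_lift_incl` (brick 1
at the pair: `G_k`, `D_μG_k` of the lift read on a component), `sdist1_lift_le`, `bound_transfer` (decay bounds pass from
the component to the lift), hypothesis transfers `regular_comp_boxI` ((1.7) on `T_η` ⇒ (1.7) for the periodic field on
the component's box), `bigBlocks_comp_boxI` (`K′ ∣ Ms_ν`, `K′ ∣ P_ν`).  §3 `exists_comp`, members `valG_lift`,
`valDG_lift`, `holder_term_lift`, `lhs19_lift`, and **`ineq19_110_liftInst`**: from the box family's `Ineq19_110` at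
every `(comp R s).boxI` (`|s| ≤ R`), `Ineq19_110` for `regionPairFam … (toInst.liftInst R)` at `(α, δ_B, c_B, R₀)` for
EVERY `R₀`.
HONEST SCOPE.  Lattice∕torus bookkeeping over existing kernel theorems (no analytic estimate); abelian one-parameter
flow, component fields, staircase∕nearest-neighbour contours, `ℓ^∞` metric, fine torus period `≥ 3`; the extra side
condition `K′ ∣ P_ν` (besides r01's `K ∣ P_ν` and r04's `K′ ∣ Ms_ν`) is OURS.  Definitions with bodies (one structure,
four `abbrev`s, two `def`s); no `Prop` fact, no `sorry`; axioms standard.  Count-neutral for YM-PLAN (typed 28∕28;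
discharged count unmoved); nothing here concerns the continuum limit, ℝ⁴, OS axioms, a mass gap or the Clay problem.
-/

namespace Literature.MathematicalPhysics.QuantumFieldTheory.Balaban1983to89.B4TorusBandLift

open Literature.MathematicalPhysics.QuantumFieldTheory.Balaban1983to89
open Literature.MathematicalPhysics.QuantumFieldTheory.Balaban1983to89.B4 (EtaSetting Ineq19_110)
open Literature.MathematicalPhysics.QuantumFieldTheory.Balaban1983to89.B4TorusPositivity (wrap wrap_eq_self_of_mem)
open Literature.MathematicalPhysics.QuantumFieldTheory.Balaban1983to89.B4Reflection242 (boxDom mem_boxDom nbrs mem_nbrs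
  blk)
open Literature.MathematicalPhysics.QuantumFieldTheory.Balaban1983to89.B4GaugeCovariance
open Literature.MathematicalPhysics.QuantumFieldTheory.Balaban1983to89.B4ContourShift (supNorm supNorm_nonneg)
open Literature.MathematicalPhysics.QuantumFieldTheory.Balaban1983to89.B4Lower18 (fineDom mem_fineDom IsBlockUnion
  fineDom_boxDom)
open Literature.MathematicalPhysics.QuantumFieldTheory.Balaban1983to89.B4Lower18Regular (e1)
open Literature.MathematicalPhysics.QuantumFieldTheory.Balaban1983to89.B4Lemma21Region (regionOp regionDeriv siteNorm)
open Literature.MathematicalPhysics.QuantumFieldTheory.Balaban1983to89.B4Lemma22ReduceZero (Box)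
open Literature.MathematicalPhysics.QuantumFieldTheory.Balaban1983to89.B4Lemma22Reduce231 (supN supN_nonneg
  siteNorm_nonneg siteNorm_zero fld_zero supN_le le_supN)
open Literature.MathematicalPhysics.QuantumFieldTheory.Balaban1983to89.B4Lemma22HolderBox (IsNNChain)
open Literature.MathematicalPhysics.QuantumFieldTheory.Balaban1983to89.B4Eq221L2FactorRegion (acBond)
open Literature.MathematicalPhysics.QuantumFieldTheory.Balaban1983to89.B4RegionCubeCarrier (incl inReg inReg_iff
  incl_injective fineDom_mono)
open Literature.MathematicalPhysics.QuantumFieldTheory.Balaban1983to89.B2Lemma24KerOmega (boxLabels mem_boxLabels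
  shiftF hnk)
open Literature.MathematicalPhysics.QuantumFieldTheory.Balaban1983to89.B4ThmRegionPairEta (RegionPairInst regionPairFam)
open Literature.MathematicalPhysics.QuantumFieldTheory.Balaban1983to89.B4ThmBoxPairEta (BoxPairInst boxPairFam)
open Literature.MathematicalPhysics.QuantumFieldTheory.Balaban1983to89.B4ThmBoxPairEtaNoCollar (boxPairFamNC)
open Literature.MathematicalPhysics.QuantumFieldTheory.Balaban1983to89.B4ThmTorusPairEta (decay_mono)
open Literature.MathematicalPhysics.QuantumFieldTheory.Balaban1983to89.B4TorusRegionOp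
open Literature.MathematicalPhysics.QuantumFieldTheory.Balaban1983to89.B4TorusRegionLift
open Literature.MathematicalPhysics.QuantumFieldTheory.Balaban1983to89.B4TorusPairFam
open Literature.MathematicalPhysics.QuantumFieldTheory.Balaban1983to89.B4LatticeBoxChart (LatBoxInst)
open Literature.MathematicalPhysics.QuantumFieldTheory.Balaban1983to89.B4RegionDecoupling (label_separated
  inv_regOp_mulVec_incl inReg_of_isNNChain exists_chain_of_isNNChain transport_map_incl isNNChain_map_incl)
open scoped Matrix

noncomputable section

variable {d : ℕ} {ι : Type} [Fintype ι] [DecidableEq ι]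

/-! ## §0. The instances: an arbitrary parallelepiped of the torus, its torus pair, and the components of its lift -/

/-- AN ARBITRARY PARALLELEPIPED `Ω` OF THE TORUS `T_η`: a scale `k ≥ 1`, the torus `P` (unit blocks per direction, fine
period `nP_ν ≥ 3`), the label box `o + Π[0, Ms) ⊆ Π_ν[0,P_ν)` of `Ω` (sides `Ms_ν ≥ 1`; NO properness condition: a
direction with `Ms_ν = P_ν` wraps all the way round), `(a, m²)` in the windows, a torus component field and a coupling
(dag-p3 g3's `TorusBoxInst` without `hwrap`). [cite: Balaban1983RegularityDecay, p.572 «a torus T_η which we identify with a rectangular parallelepiped in ηZ^d with periodic conditions», Theorem p.573 «for rectangular parallelepipeds»] -/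
structure TorusBandInst (d ℓ : ℕ) (amin aplus m2plus : ℝ) where
  /-- the scale -/
  k : ℕ
  hk : 1 ≤ k
  /-- the torus: `P_ν` unit blocks in direction `ν` -/
  P : Fin (d + 1) → ℕ
  hP : ∀ ν, 1 ≤ P ν
  h3 : ∀ ν, 3 ≤ per ((ℓ + 1) ^ k) P ν
  /-- the parallelepiped `Ω`: unit sides `Ms` and label corner `o` -/
  Ms : Fin (d + 1) → ℕ
  o : Fin (d + 1) → ℤ
  hMs : ∀ ν, 1 ≤ Ms ν
  hΩP : boxLabels Ms o ⊆ boxDom P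
  /-- the averaging weight `a` and the mass `m²` -/
  a : ℝ
  m2 : ℝ
  ha1 : amin ≤ a
  ha2 : a ≤ aplus
  hm1 : 0 ≤ m2
  hm2 : m2 ≤ m2plus
  /-- the torus component field on the period box of the fine torus -/
  Ac : (Fin (d + 1) → ℤ) → Fin (d + 1) → ℝ
  /-- the coupling -/
  e : ℝ

namespace TorusBandInst

variable {ℓ : ℕ} {amin aplus m2plus : ℝ} (j : TorusBandInst d ℓ amin aplus m2plus)

/-- THE TORUS PAIR `Ω ⊂ Ω₀ = T_η` of r01's family. [cite: Balaban1983RegularityDecay, Theorem p.573 «If Ω ⊂ Ω₀ …»] -/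
abbrev toInst : TorusPairInst d ℓ amin aplus m2plus where
  k := j.k
  hk := j.hk
  P := j.P
  hP := j.hP
  h3 := j.h3
  Ω₀T := boxDom j.P
  ΩT := boxLabels j.Ms j.o
  hbox := Finset.Subset.refl _
  hsub := j.hΩP
  a := j.a
  m2 := j.m2
  ha1 := j.ha1
  ha2 := j.ha2
  hm1 := j.hm1
  hm2 := j.hm2
  Ac := j.Ac
  e := j.e

/-- r01 g9's LIFTED LATTICE INSTANCE `Ω̃_R ⊂ Ω̃₀,R` of the torus pair (reducible alias; every carrier below is
spelled through its fields). [cite: Balaban1983RegularityDecay, p.572 «periodic conditions», dictionary] -/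
abbrev lift (R : ℕ) : RegionPairInst d ℓ amin aplus m2plus := j.toInst.liftInst R

/-- the mesh of the lifted instance is `≥ 1`. [cite: Balaban1983RegularityDecay, p.572 «η = L^{−k}», dictionary] -/
theorem hn (R : ℕ) : 1 ≤ (ℓ + 1) ^ (j.lift R).k := Nat.one_le_pow _ _ (Nat.succ_pos ℓ)

/-- THE SIDES OF A COMPONENT OF THE LIFT: `Ms_ν` in a proper direction, `(2R+1)P_ν` in a wrapping one.
[cite: Balaban1983RegularityDecay, p.572 «periodic conditions», dictionary (the periodic lift is ours)] -/
def cM (R : ℕ) : Fin (d + 1) → ℕ := fun ν => if j.Ms ν + 1 ≤ j.P ν then j.Ms ν else (2 * R + 1) * j.P ν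

/-- THE CORNER OF THE COMPONENT WITH COPY INDEX `s`: `o_ν + P_νs_ν` in a proper direction, `−RP_ν` in a wrapping one.
[cite: Balaban1983RegularityDecay, p.572 «periodic conditions», dictionary (the periodic lift is ours)] -/
def co (R : ℕ) (s : Fin (d + 1) → ℤ) : Fin (d + 1) → ℤ :=
  fun ν => if j.Ms ν + 1 ≤ j.P ν then j.o ν + (j.P ν : ℤ) * s ν else -((R : ℤ) * j.P ν)

/-- the sides of a component are positive. [cite: Balaban1983RegularityDecay, (1.1) p.572, dictionary] -/
theorem one_le_cM (R : ℕ) (ν : Fin (d + 1)) : 1 ≤ j.cM R ν := by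
  unfold cM
  split_ifs with h
  · exact j.hMs ν
  · have := j.hP ν; nlinarith

/-- THE COMPONENT `C_s` OF THE LIFT AS A LATTICE PARALLELEPIPED (`B4LatticeBoxChart.LatBoxInst`) at the periodic field,
with the lifted instance's scale, windows and coupling (reducible). [cite: Balaban1983RegularityDecay, p.572 «periodic conditions», Theorem p.573 «for rectangular parallelepipeds» (dictionary)] -/
abbrev comp (R : ℕ) (s : Fin (d + 1) → ℤ) : LatBoxInst d ℓ amin aplus m2plus where
  k := (j.lift R).k
  hk := (j.lift R).hk
  Ms := j.cM R
  o := j.co R s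
  hMs := j.one_le_cM R
  a := (j.lift R).a
  m2 := (j.lift R).m2
  ha1 := (j.lift R).ha1
  ha2 := (j.lift R).ha2
  hm1 := (j.lift R).hm1
  hm2 := (j.lift R).hm2
  Ac := (j.lift R).Ac
  e := (j.lift R).e

/-! ## §1. The lift of a parallelepiped of the torus is a union of separated translated boxes -/

section Combinatorics

omit [Fintype ι] [DecidableEq ι]

/-- the corner bounds of a label box inside the period box: `0 ≤ o_ν` and `o_ν + Ms_ν ≤ P_ν` (from the two extreme labels).
[cite: Balaban1983RegularityDecay, (1.1) p.572, dictionary] -/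
theorem corner_bounds (ν : Fin (d + 1)) : 0 ≤ j.o ν ∧ j.o ν + (j.Ms ν : ℤ) ≤ j.P ν := by
  have hlo : j.o ∈ boxLabels j.Ms j.o := by
    rw [mem_boxLabels]; intro i; have := j.hMs i; constructor <;> omega
  have hhi : (fun i => j.o i + (j.Ms i : ℤ) - 1) ∈ boxLabels j.Ms j.o := by
    rw [mem_boxLabels]; intro i; have := j.hMs i
    show j.o i ≤ j.o i + (j.Ms i : ℤ) - 1 ∧ j.o i + (j.Ms i : ℤ) - 1 < j.o i + j.Ms i
    constructor <;> omega
  have h1 : 0 ≤ j.o ν := (mem_boxDom.1 (j.hΩP hlo) ν).1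
  have h2 : j.o ν + (j.Ms ν : ℤ) - 1 < j.P ν := (mem_boxDom.1 (j.hΩP hhi) ν).2
  exact ⟨h1, by omega⟩

/-- in a wrapping direction (`¬ Ms_ν + 1 ≤ P_ν`) the box goes all the way round: `Ms_ν = P_ν` and `o_ν = 0`.
[cite: Balaban1983RegularityDecay, p.572 «periodic conditions», dictionary] -/
theorem wrap_dir {ν : Fin (d + 1)} (h : ¬ j.Ms ν + 1 ≤ j.P ν) : (j.Ms ν : ℤ) = j.P ν ∧ j.o ν = 0 := by
  obtain ⟨h1, h2⟩ := j.corner_bounds ν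
  have h3 : (j.P ν : ℤ) ≤ j.Ms ν := by exact_mod_cast Nat.lt_succ_iff.mp (Nat.lt_of_not_le h)
  exact ⟨le_antisymm (by linarith) h3, by linarith⟩

/-- `P_ν > 0`. [cite: Balaban1983RegularityDecay, p.572, dictionary] -/
theorem P_pos (ν : Fin (d + 1)) : (0 : ℤ) < j.P ν := by have := j.hP ν; exact_mod_cast this

/-- **THE COMPONENT `C_s` LIES IN THE LIFT** (`|s_ν| ≤ R`): each of its labels reduces into the box `o + Π[0,Ms)` with copy
index `s_ν` (proper directions) or some copy index in `[−R, R]` (wrapping directions). [cite: Balaban1983RegularityDecay, p.572 «periodic conditions», dictionary] -/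
theorem comp_subset_lift (R : ℕ) {s : Fin (d + 1) → ℤ} (hs : ∀ ν, |s ν| ≤ R) :
    boxLabels (j.cM R) (j.co R s) ⊆ liftLabels j.P R (boxLabels j.Ms j.o) := by
  intro y hy
  rw [mem_liftLabels_iff j.hP j.hΩP]
  rw [mem_boxLabels] at hy
  have key : ∀ ν, (j.o ν ≤ wrap j.P y ν ∧ wrap j.P y ν < j.o ν + j.Ms ν) ∧ |cidx j.P y ν| ≤ R := by
    intro ν
    obtain ⟨hy1, hy2⟩ := hy ν
    have hP0 := j.P_pos ν
    obtain ⟨ho0, hoM⟩ := j.corner_bounds ν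
    simp only [cM, co] at hy1 hy2
    show (j.o ν ≤ y ν % (j.P ν : ℤ) ∧ y ν % (j.P ν : ℤ) < j.o ν + j.Ms ν) ∧ |y ν / (j.P ν : ℤ)| ≤ R
    by_cases hpr : j.Ms ν + 1 ≤ j.P ν
    · rw [if_pos hpr] at hy1
      rw [if_pos hpr, if_pos hpr] at hy2
      -- `y = (y - P s) + P s` with `0 ≤ y - P s < P`
      have hr0 : 0 ≤ y ν - (j.P ν : ℤ) * s ν := by linarith
      have hrP : y ν - (j.P ν : ℤ) * s ν < j.P ν := by linarith
      have hdec : y ν = (y ν - (j.P ν : ℤ) * s ν) + (j.P ν : ℤ) * s ν := by ring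
      have hdiv : y ν / (j.P ν : ℤ) = s ν := by
        rw [hdec, Int.add_mul_ediv_left _ _ hP0.ne', Int.ediv_eq_zero_of_lt hr0 hrP, zero_add]
      have hmod : y ν % (j.P ν : ℤ) = y ν - (j.P ν : ℤ) * s ν := by
        rw [hdec, Int.add_mul_emod_self_left, Int.emod_eq_of_lt hr0 hrP]
        ring
      refine ⟨⟨by rw [hmod]; linarith, by rw [hmod]; linarith⟩, by rw [hdiv]; exact hs ν⟩
    · rw [if_neg hpr] at hy1
      rw [if_neg hpr, if_neg hpr] at hy2
      obtain ⟨hMP, ho⟩ := j.wrap_dir hpr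
      push_cast at hy2
      refine ⟨⟨?_, ?_⟩, ?_⟩
      · rw [ho]; exact Int.emod_nonneg _ hP0.ne'
      · rw [ho, hMP, zero_add]; exact Int.emod_lt_of_pos _ hP0
      · rw [abs_le]
        constructor
        · exact Int.le_ediv_of_mul_le hP0 (by linarith)
        · have : y ν / (j.P ν : ℤ) < R + 1 := Int.ediv_lt_of_lt_mul hP0 (by linarith)
          omega
  exact ⟨mem_boxLabels.2 fun ν => (key ν).1, fun ν => (key ν).2⟩

/-- **EVERY LABEL OF THE LIFT LIES IN THE COMPONENT OF ITS COPY INDEX** `C_{cidx y}`. [cite: Balaban1983RegularityDecay, p.572 «periodic conditions», dictionary] -/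
theorem mem_comp_cidx (R : ℕ) {y : Fin (d + 1) → ℤ} (hy : y ∈ liftLabels j.P R (boxLabels j.Ms j.o)) :
    y ∈ boxLabels (j.cM R) (j.co R (cidx j.P y)) := by
  rw [mem_liftLabels_iff j.hP j.hΩP, mem_boxLabels] at hy
  obtain ⟨hw, hc⟩ := hy
  rw [mem_boxLabels]
  intro ν
  obtain ⟨hw1, hw2⟩ := hw ν
  have hcν := abs_le.1 (hc ν)
  have hP0 := j.P_pos ν
  have hdec : y ν = y ν % (j.P ν : ℤ) + (j.P ν : ℤ) * (y ν / (j.P ν : ℤ)) := by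
    linarith [Int.mul_ediv_add_emod (y ν) (j.P ν : ℤ)]
  change j.o ν ≤ y ν % (j.P ν : ℤ) at hw1
  change y ν % (j.P ν : ℤ) < j.o ν + j.Ms ν at hw2
  simp only [cM, co, cidx]
  by_cases hpr : j.Ms ν + 1 ≤ j.P ν
  · rw [if_pos hpr, if_pos hpr]
    constructor <;> linarith
  · rw [if_neg hpr, if_neg hpr]
    push_cast
    have hr0 : 0 ≤ y ν % (j.P ν : ℤ) := Int.emod_nonneg _ hP0.ne'
    have hrP : y ν % (j.P ν : ℤ) < j.P ν := Int.emod_lt_of_pos _ hP0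
    have hl : (j.P ν : ℤ) * (-(R : ℤ)) ≤ (j.P ν : ℤ) * (y ν / (j.P ν : ℤ)) :=
      mul_le_mul_of_nonneg_left hcν.1 hP0.le
    have hu : (j.P ν : ℤ) * (y ν / (j.P ν : ℤ)) ≤ (j.P ν : ℤ) * R := mul_le_mul_of_nonneg_left hcν.2 hP0.le
    constructor <;> linarith

/-- the copy indices of a label of the lift are at most `R`. [cite: Balaban1983RegularityDecay, p.572 «periodic conditions», dictionary] -/
theorem abs_cidx_le (R : ℕ) {y : Fin (d + 1) → ℤ} (hy : y ∈ liftLabels j.P R (boxLabels j.Ms j.o)) (ν : Fin (d + 1)) :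
    |cidx j.P y ν| ≤ R :=
  ((mem_liftLabels_iff j.hP j.hΩP).1 hy).2 ν

/-- **THE COMPONENTS ARE SEPARATED**: a label of the lift within `ℓ^∞`-distance `1` of a label of `C_s` lies in `C_s`
(two translates of `o_ν + [0, Ms_ν)` by different multiples of `P_ν ≥ Ms_ν + 1` are at distance `≥ 2`).
[cite: Balaban1983RegularityDecay, p.572 «periodic conditions», (1.1) p.572 (dictionary)] -/
theorem comp_label_separated (R : ℕ) {s : Fin (d + 1) → ℤ} :
    ∀ y ∈ boxLabels (j.cM R) (j.co R s), ∀ y' ∈ liftLabels j.P R (boxLabels j.Ms j.o),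
      (∀ ν, |y' ν - y ν| ≤ 1) → y' ∈ boxLabels (j.cM R) (j.co R s) := by
  intro y hy y' hy' hclose
  have hy'c := j.mem_comp_cidx R hy'
  rw [mem_boxLabels] at hy hy'c ⊢
  intro ν
  obtain ⟨h1, h2⟩ := hy ν
  obtain ⟨h1', h2'⟩ := hy'c ν
  have hcl := abs_le.1 (hclose ν)
  simp only [cM, co] at h1 h2 h1' h2' ⊢
  have hP0 := j.P_pos ν
  by_cases hpr : j.Ms ν + 1 ≤ j.P ν
  · rw [if_pos hpr] at h1 h1' ⊢
    rw [if_pos hpr, if_pos hpr] at h2 h2'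
    rw [if_pos hpr]
    have hPM : (j.Ms ν : ℤ) + 1 ≤ j.P ν := by exact_mod_cast hpr
    -- the copy indices agree, else the two labels are `≥ 2` apart
    have hs : cidx j.P y' ν = s ν := by
      by_contra hne
      rcases lt_or_gt_of_ne hne with hlt | hgt
      · have h3 : cidx j.P y' ν + 1 ≤ s ν := by omega
        have h4 : (j.P ν : ℤ) * (cidx j.P y' ν + 1) ≤ (j.P ν : ℤ) * s ν := mul_le_mul_of_nonneg_left h3 hP0.le
        linarith
      · have h3 : s ν + 1 ≤ cidx j.P y' ν := by omega
        have h4 : (j.P ν : ℤ) * (s ν + 1) ≤ (j.P ν : ℤ) * cidx j.P y' ν := mul_le_mul_of_nonneg_left h3 hP0.le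
        linarith
    rw [hs] at h1' h2'
    exact ⟨h1', h2'⟩
  · rw [if_neg hpr] at h1' ⊢
    rw [if_neg hpr, if_neg hpr] at h2'
    rw [if_neg hpr]
    exact ⟨h1', h2'⟩

/-- **FINE-LEVEL SEPARATION** (the hypothesis `hsep` of `B4RegionDecoupling`): no nearest-neighbour bond of the fine
lattice joins the component `C_s` to the rest of the lift. [cite: Balaban1983RegularityDecay, (1.3) p.572 (Neumann bonds), dictionary] -/
theorem comp_separated (R : ℕ) (s : Fin (d + 1) → ℤ) :
    ∀ x ∈ fineDom ((ℓ + 1) ^ (j.lift R).k) (boxLabels (j.cM R) (j.co R s)),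
      ∀ z ∈ fineDom ((ℓ + 1) ^ (j.lift R).k) (j.lift R).Ωc, z ∈ nbrs x →
        z ∈ fineDom ((ℓ + 1) ^ (j.lift R).k) (boxLabels (j.cM R) (j.co R s)) :=
  label_separated (j.hn R) _ _ (j.comp_label_separated R)

/-- the component lies in the lifted instance's region (the same inclusion, spelled through the instance).
[cite: Balaban1983RegularityDecay, p.572 «periodic conditions», dictionary] -/
theorem comp_subset_liftΩ (R : ℕ) {s : Fin (d + 1) → ℤ} (hs : ∀ ν, |s ν| ≤ R) :
    boxLabels (j.cM R) (j.co R s) ⊆ (j.lift R).Ωc :=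
  j.comp_subset_lift R hs

end Combinatorics

/-! ## §2. The component inside the lift: r01's pair instance `C_s ⊂ Ω̃_R`, hypotheses of the box Theorem -/

section Pair

/-- THE PAIR `C_s ⊂ Ω̃_R` (component inside the lift) as r01's `RegionPairInst`, over the lifted instance's fields — the
object on which `B4RegionDecoupling` reads the lift component by component (reducible). [cite: Balaban1983RegularityDecay, (1.11) p.573, p.572 «periodic conditions» (dictionary)] -/
abbrev pairInst (R : ℕ) {s : Fin (d + 1) → ℤ} (hs : ∀ ν, |s ν| ≤ R) : RegionPairInst d ℓ amin aplus m2plus where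
  k := (j.lift R).k
  hk := (j.lift R).hk
  Ω₀c := (j.lift R).Ωc
  Ωc := boxLabels (j.cM R) (j.co R s)
  hsub := j.comp_subset_liftΩ R hs
  a := (j.lift R).a
  m2 := (j.lift R).m2
  ha1 := (j.lift R).ha1
  ha2 := (j.lift R).ha2
  hm1 := (j.lift R).hm1
  hm2 := (j.lift R).hm2
  Ac := (j.lift R).Ac
  e := (j.lift R).e

variable (F : OrthFlow ι) (R : ℕ) {s : Fin (d + 1) → ℤ} (hs : ∀ ν, |s ν| ≤ R) (ha : 0 < amin) (hℓ : 1 ≤ ℓ)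

omit [DecidableEq ι] in
/-- membership in the support of a source (r01's `supp`: the sites carrying a non-zero component). [cite: Balaban1983RegularityDecay, (1.9) p.573 «supp f», dictionary] -/
theorem mem_supp_iff (i : RegionPairInst d ℓ amin aplus m2plus) (f : ↥(fineDom ((ℓ + 1) ^ i.k) i.Ωc) × ι → ℝ)
    (z : ↥(fineDom ((ℓ + 1) ^ i.k) i.Ωc)) : z ∈ i.supp f ↔ ∃ c, f (z, c) ≠ 0 := by
  unfold RegionPairInst.supp
  simp only [Finset.mem_filter, Finset.mem_univ, true_and]

include ha hℓ in
/-- **`G_k` OF THE LIFT READ ON A COMPONENT IS THE COMPONENT's `G_k` ON THE RESTRICTION** (brick 1 at the pair).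
[cite: Balaban1983RegularityDecay, (1.3)–(1.6) p.572 (Neumann decoupling)] -/
theorem resR_GΩ_lift (f : ↥(fineDom ((ℓ + 1) ^ (j.lift R).k) (j.lift R).Ωc) × ι → ℝ) :
    (j.pairInst R hs).resR ((j.lift R).GΩ F *ᵥ f)
      = (j.comp R s).toRegion.GΩ F *ᵥ (j.pairInst R hs).resR f :=
  B4RegionDecoupling.resR_G₀_mulVec (j.pairInst R hs) F ha hℓ (j.comp_separated R s) f

include ha hℓ in
/-- the same at a site: `(G_k(Ω̃)f)(x̃) = (G_k(C_s)(f|_{C_s}))(a)` for `x̃ = incl a`. [cite: Balaban1983RegularityDecay, (1.6) p.572 (Neumann decoupling)] -/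
theorem fld_GΩ_lift_incl (f : ↥(fineDom ((ℓ + 1) ^ (j.lift R).k) (j.lift R).Ωc) × ι → ℝ)
    (a : ↥(fineDom ((ℓ + 1) ^ (j.lift R).k) (boxLabels (j.cM R) (j.co R s)))) :
    fld ((j.lift R).GΩ F *ᵥ f) (incl (j.hn R) (j.comp_subset_liftΩ R hs) a)
      = fld ((j.comp R s).toRegion.GΩ F *ᵥ (j.pairInst R hs).resR f) a := by
  rw [← j.resR_GΩ_lift F R hs ha hℓ f]
  rfl

include ha hℓ in
/-- **`D_μG_k` OF THE LIFT READ ON A COMPONENT**: `(D_μG_k(Ω̃)f)(x̃) = (D_μG_k(C_s)(f|_{C_s}))(a)`.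
[cite: Balaban1983RegularityDecay, (1.3)–(1.6) p.572 (Neumann decoupling)] -/
theorem fld_DΩGΩ_lift_incl (μ : Fin (d + 1)) (f : ↥(fineDom ((ℓ + 1) ^ (j.lift R).k) (j.lift R).Ωc) × ι → ℝ)
    (a : ↥(fineDom ((ℓ + 1) ^ (j.lift R).k) (boxLabels (j.cM R) (j.co R s)))) :
    fld ((j.lift R).DΩ F μ *ᵥ ((j.lift R).GΩ F *ᵥ f)) (incl (j.hn R) (j.comp_subset_liftΩ R hs) a)
      = fld ((j.comp R s).toRegion.DΩ F μ *ᵥ ((j.comp R s).toRegion.GΩ F *ᵥ (j.pairInst R hs).resR f)) a := by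
  have h := B4RegionDecoupling.fld_D₀_mulVec_incl (j.pairInst R hs) F (j.comp_separated R s) μ
    ((j.lift R).GΩ F *ᵥ f) a
  rw [j.resR_GΩ_lift F R hs ha hℓ f] at h
  exact h

omit [DecidableEq ι] in
/-- the sup norm of a restriction never exceeds the sup norm. [cite: Balaban1983RegularityDecay, (1.9) p.573 «‖f‖_∞», dictionary] -/
theorem supN_resR_le (f : ↥(fineDom ((ℓ + 1) ^ (j.lift R).k) (j.lift R).Ωc) × ι → ℝ) :
    supN ((j.pairInst R hs).resR f) ≤ supN f :=
  supN_le (supN_nonneg f) fun a => le_supN f (incl (j.hn R) (j.comp_subset_liftΩ R hs) a)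

omit [DecidableEq ι] in
/-- the restriction's support maps into the support. [cite: Balaban1983RegularityDecay, (1.9) p.573 «supp f», dictionary] -/
theorem incl_mem_supp {f : ↥(fineDom ((ℓ + 1) ^ (j.lift R).k) (j.lift R).Ωc) × ι → ℝ}
    {a' : ↥(fineDom ((ℓ + 1) ^ (j.lift R).k) (boxLabels (j.cM R) (j.co R s)))}
    (ha' : a' ∈ (j.comp R s).toRegion.supp ((j.pairInst R hs).resR f)) :
    incl (j.hn R) (j.comp_subset_liftΩ R hs) a' ∈ (j.lift R).supp f := by
  rw [mem_supp_iff] at ha' ⊢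
  exact ha'

omit [DecidableEq ι] in
/-- **DISTANCES TO THE SUPPORT ONLY GROW UNDER RESTRICTION**: `dist(x̃, supp f) ≤ dist(a, supp (f|_{C_s}))` for
`x̃ = incl a`, when the restriction is not zero. [cite: Balaban1983RegularityDecay, (1.10) p.573 «dist(x, supp f)», dictionary] -/
theorem sdist1_lift_le (f : ↥(fineDom ((ℓ + 1) ^ (j.lift R).k) (j.lift R).Ωc) × ι → ℝ)
    (a : ↥(fineDom ((ℓ + 1) ^ (j.lift R).k) (boxLabels (j.cM R) (j.co R s))))
    (hne : ((j.comp R s).toRegion.supp ((j.pairInst R hs).resR f)).Nonempty) :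
    (j.lift R).sdist1 (incl (j.hn R) (j.comp_subset_liftΩ R hs) a) f
      ≤ (j.comp R s).toRegion.sdist1 a ((j.pairInst R hs).resR f) := by
  have hne' : ((j.lift R).supp f).Nonempty := by
    obtain ⟨a', ha'⟩ := hne
    exact ⟨_, j.incl_mem_supp R hs ha'⟩
  unfold RegionPairInst.sdist1
  rw [dif_pos hne, dif_pos hne']
  refine Finset.le_inf' _ _ fun a' ha' => ?_
  exact (Finset.inf'_le _ (j.incl_mem_supp R hs ha')).trans (le_of_eq rfl)

omit [DecidableEq ι] in
/-- **THE DECAY BOUND TRANSFERS FROM THE COMPONENT TO THE LIFT**: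
`c e^{−δ dist(a, supp f|_{C_s})}‖f|_{C_s}‖_∞ ≤ c e^{−δ dist(x̃, supp f)}‖f‖_∞` (`c, δ ≥ 0`; if the restriction vanishes
the left side is `0`). [cite: Balaban1983RegularityDecay, (1.10) p.573 (bookkeeping)] -/
theorem bound_transfer {c δ : ℝ} (hc : 0 ≤ c) (hδ : 0 ≤ δ) (f : ↥(fineDom ((ℓ + 1) ^ (j.lift R).k) (j.lift R).Ωc) × ι → ℝ)
    (a : ↥(fineDom ((ℓ + 1) ^ (j.lift R).k) (boxLabels (j.cM R) (j.co R s)))) :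
    c * Real.exp (-(δ * (j.comp R s).toRegion.sdist1 a ((j.pairInst R hs).resR f)))
        * supN ((j.pairInst R hs).resR f)
      ≤ c * Real.exp (-(δ * (j.lift R).sdist1 (incl (j.hn R) (j.comp_subset_liftΩ R hs) a) f)) * supN f := by
  by_cases hne : ((j.comp R s).toRegion.supp ((j.pairInst R hs).resR f)).Nonempty
  · exact decay_mono hc hδ (j.sdist1_lift_le R hs f a hne) (j.supN_resR_le R hs f) (supN_nonneg _)
  · -- the restriction vanishes
    have h0 : supN ((j.pairInst R hs).resR f) = 0 := by
      apply le_antisymm _ (supN_nonneg _)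
      refine supN_le le_rfl fun a' => ?_
      have hz : fld ((j.pairInst R hs).resR f) a' = 0 := by
        funext c'
        by_contra h
        exact hne ⟨a', (mem_supp_iff _ _ _).2 ⟨c', h⟩⟩
      rw [hz, siteNorm_zero]
    rw [h0, mul_zero]
    have := supN_nonneg f
    positivity

variable {creg β : ℝ} {K K' : ℕ}

/-- **(1.7) TRANSFERS TO THE COMPONENT's BOX INSTANCE**: if the torus field is (1.7)-regular on `T_η`, the translated
periodic field is (1.7)-regular on the component's box `Π[0, n·cM)` (every lattice bond reduces to a torus bond).
[cite: Balaban1983RegularityDecay, (1.7) p.572] -/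
theorem regular_comp_boxI (h : (torusPairFam F d ℓ amin aplus m2plus creg β K j.toInst).regular) :
    (boxPairFamNC F d ℓ amin aplus m2plus creg β K' (j.comp R s).boxI).regular := by
  dsimp only [torusPairFam] at h
  dsimp only [boxPairFamNC, boxPairFam]
  intro x _ μ ν
  set z : Fin (d + 1) → ℤ := x + fun i => (((ℓ + 1) ^ (j.comp R s).k : ℕ) : ℤ) * (j.comp R s).o i with hz
  have hzT : twrap ((ℓ + 1) ^ j.k) j.P z ∈ fineDom ((ℓ + 1) ^ j.k) (boxDom j.P) := by
    rw [fineDom_boxDom (hnk ℓ j.k)]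
    exact twrap_mem_boxDom (hnk ℓ j.k) j.hP z
  have h' := h _ hzT μ ν
  show |perField ((ℓ + 1) ^ j.k) j.P j.Ac ((x + e1 μ) + fun i => (((ℓ + 1) ^ (j.comp R s).k : ℕ) : ℤ) * (j.comp R s).o i) ν
      - perField ((ℓ + 1) ^ j.k) j.P j.Ac (x + fun i => (((ℓ + 1) ^ (j.comp R s).k : ℕ) : ℤ) * (j.comp R s).o i) ν| ≤ _
  rw [add_right_comm x (e1 μ), ← hz]
  simp only [perField, twrap_twrap_add] at h' ⊢
  exact h'

/-- **THE BIG-BLOCK CLAUSE OF THE COMPONENT's BOX INSTANCE** from `K′ ∣ Ms_ν` and `K′ ∣ P_ν` (the component's sides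
are `Ms_ν` or `(2R+1)P_ν`). [cite: Balaban1983RegularityDecay, p.572 «unions of big blocks»] -/
theorem bigBlocks_comp_boxI (hMs : ∀ ν, K' ∣ j.Ms ν) (hPK : ∀ ν, K' ∣ j.P ν) :
    (boxPairFamNC F d ℓ amin aplus m2plus creg β K' (j.comp R s).boxI).bigBlocks := by
  have h : ∀ ν, K' ∣ j.cM R ν := by
    intro ν
    unfold cM
    split_ifs
    · exact hMs ν
    · exact Dvd.dvd.mul_left (hPK ν) _
  exact ⟨h, h⟩

end Pair

/-! ## §3. The members of (1.9)–(1.10) at every site of the lift, from the box Theorem on the components -/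

section Members

variable (F : OrthFlow ι) (R : ℕ) {creg β : ℝ} {K K' : ℕ} {α δB cB RB : ℝ} (ha : 0 < amin) (hℓ : 1 ≤ ℓ)
  (hδB : 0 < δB) (hcB : 0 < cB)
  (HB : ∀ (s : Fin (d + 1) → ℤ), (∀ ν, |s ν| ≤ R) →
    Ineq19_110 (boxPairFamNC F d ℓ amin aplus m2plus creg β K' (j.comp R s).boxI) α δB cB RB)

/-- the component of a site of the lift: its label's copy index `s`, the site read in `C_s`, and `incl a = x̃`.
[cite: Balaban1983RegularityDecay, p.572 «periodic conditions» (dictionary)] -/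
theorem exists_comp (x : ↥(fineDom ((ℓ + 1) ^ (j.lift R).k) (j.lift R).Ωc)) :
    ∃ (s : Fin (d + 1) → ℤ) (hs : ∀ ν, |s ν| ≤ R)
      (a : ↥(fineDom ((ℓ + 1) ^ (j.lift R).k) (boxLabels (j.cM R) (j.co R s)))),
      incl (j.hn R) (j.comp_subset_liftΩ R hs) a = x := by
  have hy : blk ((ℓ + 1) ^ (j.lift R).k) x.1 ∈ liftLabels j.P R (boxLabels j.Ms j.o) := (mem_fineDom (j.hn R)).1 x.2
  refine ⟨cidx j.P (blk ((ℓ + 1) ^ (j.lift R).k) x.1), j.abs_cidx_le R hy,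
    ⟨x.1, (mem_fineDom (j.hn R)).2 (j.mem_comp_cidx R hy)⟩, Subtype.ext rfl⟩

include ha hℓ hδB hcB HB in
/-- **(1.10), VALUE, AT EVERY SITE OF THE LIFT**: `|(G_k(Ω̃_R, A^per)f)(x̃)| ≤ c_B e^{−δ_B dist(x̃, supp f)}‖f‖_∞`.
[cite: Balaban1983RegularityDecay, (1.10) p.573 «for rectangular parallelepipeds … without any restrictions»] -/
theorem valG_lift (f : ↥(fineDom ((ℓ + 1) ^ (j.lift R).k) (j.lift R).Ωc) × ι → ℝ)
    (x : ↥(fineDom ((ℓ + 1) ^ (j.lift R).k) (j.lift R).Ωc)) :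
    siteNorm (fld ((j.lift R).GΩ F *ᵥ f) x) ≤ cB * Real.exp (-(δB * (j.lift R).sdist1 x f)) * supN f := by
  obtain ⟨s, hs, a, rfl⟩ := j.exists_comp R x
  rw [j.fld_GΩ_lift_incl F R hs ha hℓ f a]
  have h1 : siteNorm (fld ((j.comp R s).toRegion.GΩ F *ᵥ (j.pairInst R hs).resR f) a)
      ≤ cB * Real.exp (-(δB * (j.comp R s).toRegion.sdist1 a ((j.pairInst R hs).resR f)))
        * supN ((j.pairInst R hs).resR f) :=
    (j.comp R s).valG_region F (K := K') (HB s hs) _ a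
  exact h1.trans (j.bound_transfer R hs hcB.le hδB.le f a)

include ha hℓ hδB hcB HB in
/-- **(1.10), DERIVATIVE, AT EVERY SITE OF THE LIFT.** [cite: Balaban1983RegularityDecay, (1.10) p.573 «for rectangular parallelepipeds … without any restrictions»] -/
theorem valDG_lift (μ : Fin (d + 1)) (f : ↥(fineDom ((ℓ + 1) ^ (j.lift R).k) (j.lift R).Ωc) × ι → ℝ)
    (x : ↥(fineDom ((ℓ + 1) ^ (j.lift R).k) (j.lift R).Ωc)) :
    siteNorm (fld ((j.lift R).DΩ F μ *ᵥ ((j.lift R).GΩ F *ᵥ f)) x)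
      ≤ cB * Real.exp (-(δB * (j.lift R).sdist1 x f)) * supN f := by
  obtain ⟨s, hs, a, rfl⟩ := j.exists_comp R x
  rw [j.fld_DΩGΩ_lift_incl F R hs ha hℓ μ f a]
  have h1 : siteNorm (fld ((j.comp R s).toRegion.DΩ F μ *ᵥ
      ((j.comp R s).toRegion.GΩ F *ᵥ (j.pairInst R hs).resR f)) a)
      ≤ cB * Real.exp (-(δB * (j.comp R s).toRegion.sdist1 a ((j.pairInst R hs).resR f)))
        * supN ((j.pairInst R hs).resR f) :=
    (j.comp R s).valDG_region F (K := K') (HB s hs) μ _ a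
  exact h1.trans (j.bound_transfer R hs hcB.le hδB.le f a)

include ha hℓ hδB hcB HB in
/-- **THE HÖLDER TERM OF AN ADMISSIBLE CONTOUR OF THE LIFT**: the contour stays in the component of its start (brick 1),
where it is admissible with the same weight, transporter and end values, so its term is bounded by the component's
`holderQ` — (1.9) on the component (brick 2) — and the decay transfers. [cite: Balaban1983RegularityDecay, (1.9) p.573 «for rectangular parallelepipeds … without any restrictions»] -/
theorem holder_term_lift {μ : Fin (d + 1)} (f : ↥(fineDom ((ℓ + 1) ^ (j.lift R).k) (j.lift R).Ωc) × ι → ℝ)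
    {s : Fin (d + 1) → ℤ} (hs : ∀ ν, |s ν| ≤ R)
    (a : ↥(fineDom ((ℓ + 1) ^ (j.lift R).k) (boxLabels (j.cM R) (j.co R s))))
    {x' : ↥(fineDom ((ℓ + 1) ^ (j.lift R).k) (j.lift R).Ωc)} {L : List ↥(fineDom ((ℓ + 1) ^ (j.lift R).k) (j.lift R).Ωc)}
    (hL : (j.lift R).Adm μ (incl (j.hn R) (j.comp_subset_liftΩ R hs) a) x' L) :
    (j.lift R).wt α (incl (j.hn R) (j.comp_subset_liftΩ R hs) a) x' *
        siteNorm (transport (fieldLink F (j.lift R).κ (acBond (j.lift R).Ωc (j.lift R).Ac))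
          (incl (j.hn R) (j.comp_subset_liftΩ R hs) a) L *ᵥ fld ((j.lift R).DΩ F μ *ᵥ ((j.lift R).GΩ F *ᵥ f)) x'
          - fld ((j.lift R).DΩ F μ *ᵥ ((j.lift R).GΩ F *ᵥ f)) (incl (j.hn R) (j.comp_subset_liftΩ R hs) a))
      ≤ cB * Real.exp (-(δB * min ((j.lift R).sdist1 (incl (j.hn R) (j.comp_subset_liftΩ R hs) a) f)
          ((j.lift R).sdist1 x' f))) * supN f := by
  obtain ⟨hbx, hbx', hne, hpath, hend, hlen, hball⟩ := hL
  -- the contour is the image of a contour of the component; its end point lies in the component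
  obtain ⟨l, hLl, hch, hendl⟩ :=
    exists_chain_of_isNNChain (j.hn R) _ _ (j.comp_subset_liftΩ R hs) (j.comp_separated R s) a L hpath
  subst hLl
  have hx' : x' = incl (j.hn R) (j.comp_subset_liftΩ R hs) (pathEnd a l) := by rw [← hend, hendl]
  subst hx'
  -- the contour is admissible in the component
  have hsep := j.comp_separated R s
  have hbond : ∀ (b : ↥(fineDom ((ℓ + 1) ^ (j.lift R).k) (boxLabels (j.cM R) (j.co R s)))),
      (incl (j.hn R) (j.comp_subset_liftΩ R hs) b).1 + e1 μ ∈ fineDom ((ℓ + 1) ^ (j.lift R).k) (j.lift R).Ωc →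
        b.1 + e1 μ ∈ fineDom ((ℓ + 1) ^ (j.lift R).k) (boxLabels (j.cM R) (j.co R s)) :=
    fun b h => hsep b.1 b.2 _ h (mem_nbrs.2 ⟨μ, Or.inl rfl⟩)
  have hadm : (j.comp R s).toRegion.Adm μ a (pathEnd a l) l := by
    refine ⟨hbond a hbx, hbond (pathEnd a l) hbx', hne, hch, rfl, ?_, ?_⟩
    · rw [List.length_map] at hlen
      exact hlen
    · intro z hz
      exact hball (incl (j.hn R) (j.comp_subset_liftΩ R hs) z) (List.mem_map.2 ⟨z, hz, rfl⟩)
  -- same transporter, same end values, same weight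
  rw [transport_map_incl F _ (j.hn R) _ _ (j.comp_subset_liftΩ R hs) _ a l,
    j.fld_DΩGΩ_lift_incl F R hs ha hℓ μ f, j.fld_DΩGΩ_lift_incl F R hs ha hℓ μ f]
  have h1 := B4Thm19ShortestContour.le_holderQ (j.comp R s).toRegion F (α := α)
    ((j.comp R s).toRegion.DΩ F μ *ᵥ ((j.comp R s).toRegion.GΩ F *ᵥ (j.pairInst R hs).resR f)) hadm
  have h2 : (j.comp R s).toRegion.holderQ F α μ
      ((j.comp R s).toRegion.DΩ F μ *ᵥ ((j.comp R s).toRegion.GΩ F *ᵥ (j.pairInst R hs).resR f)) a (pathEnd a l)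
      ≤ cB * Real.exp (-(δB * min ((j.comp R s).toRegion.sdist1 a ((j.pairInst R hs).resR f))
          ((j.comp R s).toRegion.sdist1 (pathEnd a l) ((j.pairInst R hs).resR f))))
        * supN ((j.pairInst R hs).resR f) :=
    (j.comp R s).lhs19_region F (K := K') hcB (HB s hs) μ _ a (pathEnd a l)
  refine (h1.trans h2).trans ?_
  have hsf := supN_nonneg f
  -- decay transfer at the nearer of the two points
  rcases le_total ((j.comp R s).toRegion.sdist1 a ((j.pairInst R hs).resR f))
      ((j.comp R s).toRegion.sdist1 (pathEnd a l) ((j.pairInst R hs).resR f)) with hle | hle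
  · rw [min_eq_left hle]
    exact (j.bound_transfer R hs hcB.le hδB.le f a).trans (decay_mono hcB.le hδB.le (min_le_left _ _) le_rfl hsf)
  · rw [min_eq_right hle]
    exact (j.bound_transfer R hs hcB.le hδB.le f (pathEnd a l)).trans
      (decay_mono hcB.le hδB.le (min_le_right _ _) le_rfl hsf)

include ha hℓ hδB hcB HB in
/-- **(1.9) AT EVERY PAIR OF SITES OF THE LIFT.** [cite: Balaban1983RegularityDecay, (1.9) p.573 «for rectangular parallelepipeds … without any restrictions»] -/
theorem lhs19_lift (μ : Fin (d + 1)) (f : ↥(fineDom ((ℓ + 1) ^ (j.lift R).k) (j.lift R).Ωc) × ι → ℝ)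
    (x x' : ↥(fineDom ((ℓ + 1) ^ (j.lift R).k) (j.lift R).Ωc)) :
    (j.lift R).holderQ F α μ ((j.lift R).DΩ F μ *ᵥ ((j.lift R).GΩ F *ᵥ f)) x x'
      ≤ cB * Real.exp (-(δB * min ((j.lift R).sdist1 x f) ((j.lift R).sdist1 x' f))) * supN f := by
  obtain ⟨s, hs, a, rfl⟩ := j.exists_comp R x
  have hsf := supN_nonneg f
  exact (j.lift R).holderQ_le F (by positivity) fun L hL => j.holder_term_lift F R ha hℓ hδB hcB HB f hs a hL

set_option maxHeartbeats 400000 in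
include ha hℓ hδB hcB HB in
/-- **THEOREM (1.9)–(1.10) ON THE LIFT OF AN ARBITRARY PARALLELEPIPED OF THE TORUS, WITHOUT RESTRICTION**:
`Ineq19_110` for r01's lifted instance at `(α, δ_B, c_B)` and EVERY `R₀` — in particular `R₀ = 0`, the hypothesis of
r01 g9's lifting members `valG_torus`, `valDG_torus`, `lhs19_torus` with no point of the band excluded.
[cite: Balaban1983RegularityDecay, Theorem (1.9)–(1.10) p.573 «for rectangular parallelepipeds, the inequalities hold without any restrictions on the points x, x′»] -/
theorem ineq19_110_liftInst (R₀ : ℝ) :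
    Ineq19_110 (regionPairFam F d ℓ amin aplus m2plus creg β K (j.toInst.liftInst R)) α δB cB R₀ :=
  ⟨fun μ f x x' _ => j.lhs19_lift F R ha hℓ hδB hcB HB μ f x x',
    fun μ f x _ => ⟨j.valDG_lift F R ha hℓ hδB hcB HB μ f x, j.valG_lift F R ha hℓ hδB hcB HB f x⟩⟩

end Members


end TorusBandInst

end

end Literature.MathematicalPhysics.QuantumFieldTheory.Balaban1983to89.B4TorusBandLift
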